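import Literature.MathematicalPhysics.QuantumFieldTheory.Balaban1983to89.B7Prop7Ck
import Literature.MathematicalPhysics.QuantumFieldTheory.Balaban1983to89.B11Ineq189LocalLeaf

/-!
# `Balaban1983to89.B11Ineq189LeafCk` — T. Bałaban, *The variational problem and background fields in renormalization group method for
# lattice gauge theories*, Commun. Math. Phys. **102** (1985) 277–309 [Balaban1985Variational], p. 308, the author-omitted second
# differentiation behind (189): the local analytic leaf INSTANTIATED FOR BAŁABAN'S `C_k(U′U₀, ·)` of [Balaban1985Averaging] Props. 4/7 — a
# CONCRETE second-derivative bound `‖D²C_k(U′U₀, ·)(c)(X)[u, v]‖ ≤ 9·C₂·‖u‖‖v‖` on the insertion spaces of the `ℤᵈ` carrier, with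
# `C₂ = 8C₁′e^{E}L^{2k}` the explicit constant of (135) in the tree

statement-level skeleton of published theorems with citation tags; proofs where landed; nothing here is a claim about the Yang–Mills mass gap

PDF held: `paper:balaban1985-cmp102-variational-background` (journal page = PDF page + 276), p. 308 [PDF 32]; `paper:balaban1985-cmp98-averaging`
(journal page = PDF page + 16), pp. 38–39, 43.  Displays in the transcriptions of record of `B11Ineq189` / `B7Prop7Ck` / `B7Prop7Levels`.

CITATION HEADER (lean-in-tree rule 2026-08-18).  WHAT IS REPRODUCED: SKELETON rows **B11.Eq189** (GAPS G-B11-G2 KEY: *«Now we have to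
differentiate those expressions second time. We do not perform these calculations here»*, p. 308; cell census `SECOND-DERIVATIVE-189.md` §4:
the located unprinted intermediate δ𝔇 = (δ²/δA′²)D has the LOCAL LEAF `Φ_c[u, v] = (Lʲη)²∂_s∂_tC_j(X + su + tv)|₀` with *«LEAF BOUND
|Φ_c[u, v]| ≤ 9C₂|u|_∞|v|_∞ … LOCAL, no ε»*) and **B7.Prop7** / **B7.Prop4** ([4] p. 43: *«Proposition 7. For U₀ satisfying (52) and
U′ = e^{iηA′}, |A′| < α₁, α₀, α₁ sufficiently small, the function Q_k(U′U₀, ηA) is analytic in complex variables A′, A, and Proposition 4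
holds uniformly in A′.»*; p. 38: *«Q_k(U₀, ηA) = Q_k(U₀)A + C_k(U₀, A), (134) |C_k(U₀, A)| < C₂|A|², (135)»*).  The generic leaf is the
sibling `B11Ineq189LocalLeaf` (two-variable Cauchy estimate; `norm_d2_le_of_quad`); the concrete analyticity and the concrete (135) are r04's
`B7Prop7Ck.prop7_Ck_ins` and `B7Prop7Levels.prop7_prop4_uniform` (constant `8C₁′e^{E}(Lᵏb)²`, `C₁′ = 2097152(d+1)²`,
`E = 4480(d+1)²(d+4)α₀ + 240000(d+1)³Lᵏb′`).  THIS FILE composes them.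

WHAT IS CERTIFIED (kernel, sorry-free; standard axioms; theorems only), under the DATA of `B7Prop7Ck` (complete normed ℂ-algebra `𝔸` with
‖1‖ = 1, `L ≥ 2`, an averaging-closed subgroup `G ∋ U₀(x, κ)`, plaquette deviation `pdev U₀ < α₀L^{−2k}` with the three α₀-smallness
inequalities, the background perturbation `U′ = e^{B′}`, `sup‖B′‖ ≤ b′` with its three smallness inequalities, and a polydisc radius `ρ` for
the inserted field with its two), for every finite set `S` of bonds (the insertion space `𝔸^S`, sup norm) and every `Lᵏ`-bond `c = (z, κ)`,
writing `C(a) := Q_k(U′U₀, η·ins_S a)(c) − LᵏηQ_k(U′U₀)(ins_S a)(c)` (= `C_k(U′U₀, ins_S a)(c)`):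
* `quad_Ck_ins` — (135) on the insertion ball: `‖a‖ < ρ ⟹ ‖C(a)‖ ≤ C₂‖a‖²`, `C₂ = 8C₁′e^{E}(Lᵏ)²`;
* `differentiableOn_Ck_ins` — `C` is complex-differentiable on the ball `‖a‖ < ρ` (Prop. 7);
* **`norm_d2_Ck_ins`** — `‖X‖ < ρ/3 ⟹ ‖∂_u∂_v C(X)‖ ≤ 9C₂‖u‖‖v‖`; `norm_fderiv_fderiv_Ck_ins` (`D²C(X) u v`): the number β of
  `B11Ineq189.hasMaj₂_local` FOR BAŁABAN'S C_k (applied bilinear form), uniform in the centre `X`, in `U′` and in `c`;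
* `norm_d2_Ck_ins_zero` — at `X = 0`: the polarised quadratic form of `C_k^{(2)}(U′U₀, ·)(c)` of (136) (`δ𝔇(0) = Φ⁰` of the census) is ≤ 9C₂‖u‖‖v‖;
* `norm_d1_Ck_ins` — p. 291 *«the power of |A| lower by 1»*: `2‖X‖ < ρ ⟹ ‖∂_v C(X)‖ ≤ 4C₂‖X‖‖v‖`.

HONEST SCOPE.  The bound is at the level of the NORMS of the insertion space (sup over the inserted bonds) — the block-LOCAL form `hloc` of
`B11Ineq189.hasMaj₂_local` additionally uses that `C_k(·)(c)` depends only on the bonds of `B(c) = Bᵏ(c₋) ∪ Bᵏ(c₊)` ([4] Prop. 4), which is the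
choice `S ⊆ B(c)` here and is not re-proved; the thresholds are r04's explicit `d`-dependent witnesses of «sufficiently small» (DIVERGENCE of
`B7Prop7Levels`); (189) itself stays the located leaf (G-B11-G2) — this is its first CONCRETE term-leaf.  Seat pub-ymgap-dag-n07-b (HUMAN
RULING D-0062, node N07 [B11]; «MISSING ESTIMATE N07: (189) p. 308, leaf U2 for C_k»).  Imports `B7Prop7Ck`, `B11Ineq189LocalLeaf`;
modifies nothing; no definition, no new named fact.
-/

noncomputable section

open scoped BigOperators
open NormedSpace Metric Set Finset

namespace Literature.MathematicalPhysics.QuantumFieldTheory.Balaban1983to89.B11Ineq189LeafCk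

open Literature.MathematicalPhysics.QuantumFieldTheory.Balaban1983to89
open B7Prop1Explicit B7Prop2Explicit B7Prop3Flat MatrixLog B7Eq92Concrete B7Prop3GeneralAnalytic B7Prop3GeneralLinear
  B7Prop4GeneralLevels B7Prop7OneStep B7Prop7Levels B7Prop7Ins B7Prop7Ck B11Ineq189LocalLeaf

variable {d : ℕ}

variable {𝔸 : Type*} [NormedRing 𝔸] [NormedAlgebra ℂ 𝔸] [CompleteSpace 𝔸] [NormOneClass 𝔸]

variable (L : ℕ) (hL : 2 ≤ L) {G : Subgroup 𝔸ˣ} (hG : AvgClosed d L G) (k : ℕ)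
  (U₀ : B7Prop1Explicit.Site d → Fin d → 𝔸ˣ) (hU₀ : ∀ x κ, U₀ x κ ∈ G) {α₀ : ℝ} (hα : 0 < α₀)
  (hα3 : C0 d * α₀ ≤ 1 / 3) (hα8 : 8 * α₀ ≤ c2' d L) (h52 : pdev U₀ < α₀ * (((L : ℝ) ^ k)⁻¹) ^ 2)
  (B' : B7Prop1Explicit.Site d → Fin d → 𝔸) {b' : ℝ} (hb' : 0 ≤ b') (hB' : ∀ x κ, ‖B' x κ‖ ≤ b')
  (hsmall' : Real.exp (4 * (800 * ((d : ℝ) + 1) ^ 2 * ((d : ℝ) + 4)) * α₀)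
    * (1 + 8 * (131072 * ((d : ℝ) + 1) ^ 2) * ((L : ℝ) ^ k * b')) ≤ 2)
  (hc₃' : 2 * ((L : ℝ) ^ k * b') ≤ c3 d L) (hb'1 : 409600 * ((d : ℝ) + 1) ^ 2 * ((L : ℝ) ^ k * b') ≤ 1)
  {ρ : ℝ} (hρ : 0 < ρ)
  (hρsmall : Real.exp (4480 * ((d : ℝ) + 1) ^ 2 * ((d : ℝ) + 4) * α₀ + 240000 * ((d : ℝ) + 1) ^ 3 * ((L : ℝ) ^ k * b'))
    * (1 + 8 * (2097152 * ((d : ℝ) + 1) ^ 2) * ((L : ℝ) ^ k * ρ)) ≤ 2)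
  (hρc₃ : 2 * ((L : ℝ) ^ k * ρ) ≤ c3 d L / 4)

/-! ## §1 (135) and Prop. 7 on the insertion ball: the hypotheses of the generic leaf -/

include hL hG hU₀ hα hα3 hα8 h52 hb' hB' hsmall' hc₃' hb'1 hρsmall hρc₃ in
/-- **(135) on the insertion ball, AT THE COMPLEX BACKGROUND** (`B7Prop7Levels.prop7_prop4_uniform` at `j = k`, `b = ‖a‖`): for ‖a‖ < ρ,
`‖C_k(U′U₀, ins_S a)(c)‖ ≤ C₂‖a‖²` with `C₂ = 8C₁′e^{E}(Lᵏ)²` — the quadratic bound the leaf needs, with the tree's explicit constant.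
[cite: Balaban1985Averaging, Prop. 4 (135) p.38, Prop. 7 p.43] -/
theorem quad_Ck_ins (S : Finset (B7Prop1Explicit.Site d × Fin d)) (z : B7Prop1Explicit.Site d) (κ : Fin d) (a : S → 𝔸) (ha : ‖a‖ < ρ) :
    ‖logCovIter L (expCfg B' * U₀) (insCfg S a) k z κ - linCovIter L (expCfg B' * U₀) (insCfg S a) k z κ‖ ≤
      (8 * (2097152 * ((d : ℝ) + 1) ^ 2)
        * Real.exp (4480 * ((d : ℝ) + 1) ^ 2 * ((d : ℝ) + 4) * α₀ + 240000 * ((d : ℝ) + 1) ^ 3 * ((L : ℝ) ^ k * b'))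
        * ((L : ℝ) ^ k) ^ 2) * ‖a‖ ^ 2 := by
  obtain ⟨-, -, -, hs, hc⟩ := smallness7_mono (d := d) (L := L) (k := k) (α₀ := α₀) le_rfl (norm_nonneg a) ha.le
    hsmall' hc₃' hb'1 hρsmall hρc₃
  have h := (prop7_prop4_uniform L hL hG k U₀ hU₀ hα hα3 hα8 h52 B' hb' hB' hsmall' hc₃' hb'1 (insCfg S a) (norm_nonneg a)
    (fun x κ' => norm_insCfg_le S a x κ') hs hc k le_rfl).1 z κ
  calc ‖logCovIter L (expCfg B' * U₀) (insCfg S a) k z κ - linCovIter L (expCfg B' * U₀) (insCfg S a) k z κ‖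
      ≤ 8 * (2097152 * ((d : ℝ) + 1) ^ 2)
          * Real.exp (4480 * ((d : ℝ) + 1) ^ 2 * ((d : ℝ) + 4) * α₀ + 240000 * ((d : ℝ) + 1) ^ 3 * ((L : ℝ) ^ k * b'))
          * ((L : ℝ) ^ k * ‖a‖) ^ 2 := h
    _ = _ := by ring

include hL hG hU₀ hα hα3 hα8 h52 hb' hB' hsmall' hc₃' hb'1 hρ hρsmall hρc₃ in
/-- **`C_k(U′U₀, ins_S ·)(c)` is complex-differentiable on the insertion ball `‖a‖ < ρ`** (Prop. 7, `B7Prop7Ck.prop7_Ck_ins`; the sup-norm ball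
lies in the polydisc). [cite: Balaban1985Averaging, Prop. 7 p.43] -/
theorem differentiableOn_Ck_ins (S : Finset (B7Prop1Explicit.Site d × Fin d)) (z : B7Prop1Explicit.Site d) (κ : Fin d) :
    DifferentiableOn ℂ (fun a : S → 𝔸 =>
        logCovIter L (expCfg B' * U₀) (insCfg S a) k z κ - linCovIter L (expCfg B' * U₀) (insCfg S a) k z κ)
      (ball (0 : S → 𝔸) ρ) := by
  have h := (prop7_Ck_ins L hL hG k U₀ hU₀ hα hα3 hα8 h52 B' hb' hB' hsmall' hc₃' hb'1 hρ hρsmall hρc₃ S z κ).1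
  refine (h.mono fun a ha => ?_).differentiableOn
  rw [mem_ball_zero_iff] at ha
  exact fun s => (norm_le_pi_norm a s).trans_lt ha

/-! ## §2 The second-derivative leaf for `C_k` -/

include hL hG hU₀ hα hα3 hα8 h52 hb' hB' hsmall' hc₃' hb'1 hρ hρsmall hρc₃ in
/-- **THE LEAF BOUND U2 FOR BAŁABAN'S C_k** (the author-omitted second differentiation of p. 308 at its local analytic leaf): for every centre
`X` of the insertion space with `‖X‖ < ρ/3` and all directions `u, v`,
`‖∂_u∂_v C_k(U′U₀, ins_S ·)(c)(X)‖ ≤ 9·C₂·‖u‖‖v‖`, `C₂ = 8C₁′e^{E}(Lᵏ)²` — `B11Ineq189LocalLeaf.norm_d2_le_of_quad` with §1.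
[cite: Balaban1985Variational, (189) p.308] [cite: Balaban1985Averaging, Prop. 4 (134)–(135) p.38, Prop. 7 p.43] -/
theorem norm_d2_Ck_ins (S : Finset (B7Prop1Explicit.Site d × Fin d)) (z : B7Prop1Explicit.Site d) (κ : Fin d) {X : S → 𝔸} (hX : ‖X‖ < ρ / 3) (u v : S → 𝔸) :
    ‖fderiv ℂ (fun Y : S → 𝔸 => fderiv ℂ (fun a : S → 𝔸 =>
        logCovIter L (expCfg B' * U₀) (insCfg S a) k z κ - linCovIter L (expCfg B' * U₀) (insCfg S a) k z κ) Y v) X u‖ ≤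
      9 * (8 * (2097152 * ((d : ℝ) + 1) ^ 2)
        * Real.exp (4480 * ((d : ℝ) + 1) ^ 2 * ((d : ℝ) + 4) * α₀ + 240000 * ((d : ℝ) + 1) ^ 3 * ((L : ℝ) ^ k * b'))
        * ((L : ℝ) ^ k) ^ 2) * ‖u‖ * ‖v‖ :=
  norm_d2_le_of_quad (differentiableOn_Ck_ins L hL hG k U₀ hU₀ hα hα3 hα8 h52 B' hb' hB' hsmall' hc₃' hb'1 hρ hρsmall hρc₃ S z κ)
    (by positivity) (fun Y hY => quad_Ck_ins L hL hG k U₀ hU₀ hα hα3 hα8 h52 B' hb' hB' hsmall' hc₃' hb'1 hρsmall hρc₃ S z κ Y hY)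
    hX u v

include hL hG hU₀ hα hα3 hα8 h52 hb' hB' hsmall' hc₃' hb'1 hρ hρsmall hρc₃ in
/-- The same for the second Fréchet derivative `D²C_k(X) u v`. [cite: Balaban1985Variational, (189) p.308]
[cite: Balaban1985Averaging, Prop. 4 (134)–(135) p.38] -/
theorem norm_fderiv_fderiv_Ck_ins (S : Finset (B7Prop1Explicit.Site d × Fin d)) (z : B7Prop1Explicit.Site d) (κ : Fin d) {X : S → 𝔸} (hX : ‖X‖ < ρ / 3)
    (u v : S → 𝔸) :
    ‖fderiv ℂ (fderiv ℂ (fun a : S → 𝔸 =>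
        logCovIter L (expCfg B' * U₀) (insCfg S a) k z κ - linCovIter L (expCfg B' * U₀) (insCfg S a) k z κ)) X u v‖ ≤
      9 * (8 * (2097152 * ((d : ℝ) + 1) ^ 2)
        * Real.exp (4480 * ((d : ℝ) + 1) ^ 2 * ((d : ℝ) + 4) * α₀ + 240000 * ((d : ℝ) + 1) ^ 3 * ((L : ℝ) ^ k * b'))
        * ((L : ℝ) ^ k) ^ 2) * ‖u‖ * ‖v‖ :=
  norm_fderiv_fderiv_quad_le
    (differentiableOn_Ck_ins L hL hG k U₀ hU₀ hα hα3 hα8 h52 B' hb' hB' hsmall' hc₃' hb'1 hρ hρsmall hρc₃ S z κ)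
    (by positivity) (fun Y hY => quad_Ck_ins L hL hG k U₀ hU₀ hα hα3 hα8 h52 B' hb' hB' hsmall' hc₃' hb'1 hρsmall hρc₃ S z κ Y hY)
    hX u v

include hL hG hU₀ hα hα3 hα8 h52 hb' hB' hsmall' hc₃' hb'1 hρ hρsmall hρc₃ in
/-- **At the origin**: the quadratic form `D²C_k(U′U₀, ins_S ·)(c)(0)[u, v]` — twice the second-order term `C_k^{(2)}(U′U₀, ·)(c)` of (136)
polarised, the purely LOCAL piece `Φ⁰` of δ𝔇(0) in the census — is bounded by `9C₂‖u‖‖v‖`. [cite: Balaban1985Averaging, (136) p.39]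
[cite: Balaban1985Variational, (189) p.308] -/
theorem norm_d2_Ck_ins_zero (S : Finset (B7Prop1Explicit.Site d × Fin d)) (z : B7Prop1Explicit.Site d) (κ : Fin d) (u v : S → 𝔸) :
    ‖fderiv ℂ (fderiv ℂ (fun a : S → 𝔸 =>
        logCovIter L (expCfg B' * U₀) (insCfg S a) k z κ - linCovIter L (expCfg B' * U₀) (insCfg S a) k z κ)) 0 u v‖ ≤
      9 * (8 * (2097152 * ((d : ℝ) + 1) ^ 2)
        * Real.exp (4480 * ((d : ℝ) + 1) ^ 2 * ((d : ℝ) + 4) * α₀ + 240000 * ((d : ℝ) + 1) ^ 3 * ((L : ℝ) ^ k * b'))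
        * ((L : ℝ) ^ k) ^ 2) * ‖u‖ * ‖v‖ :=
  norm_fderiv_fderiv_Ck_ins L hL hG k U₀ hU₀ hα hα3 hα8 h52 B' hb' hB' hsmall' hc₃' hb'1 hρ hρsmall hρc₃ S z κ
    (by rw [norm_zero]; positivity) u v

/-! ## §3 «the power of |A| lower by 1» for `C_k` -/

include hL hG hU₀ hα hα3 hα8 h52 hb' hB' hsmall' hc₃' hb'1 hρ hρsmall hρc₃ in
/-- **The first derivative of `C_k` near the origin**: for `2‖X‖ < ρ`, `‖∂_v C_k(U′U₀, ins_S ·)(c)(X)‖ ≤ 4C₂‖X‖‖v‖` — the mechanism of p. 291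
(Cauchy at the printed radius of (185)–(186)) for Bałaban's local functional; at `X = 0` this is `D C_k(0) = 0` of (134)/(136).
[cite: Balaban1985Variational, p.291 + (185)–(186) p.308] [cite: Balaban1985Averaging, Prop. 4 (134)–(135) p.38] -/
theorem norm_d1_Ck_ins (S : Finset (B7Prop1Explicit.Site d × Fin d)) (z : B7Prop1Explicit.Site d) (κ : Fin d) {X : S → 𝔸} (hX : 2 * ‖X‖ < ρ) (v : S → 𝔸) :
    ‖fderiv ℂ (fun a : S → 𝔸 =>
        logCovIter L (expCfg B' * U₀) (insCfg S a) k z κ - linCovIter L (expCfg B' * U₀) (insCfg S a) k z κ) X v‖ ≤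
      4 * (8 * (2097152 * ((d : ℝ) + 1) ^ 2)
        * Real.exp (4480 * ((d : ℝ) + 1) ^ 2 * ((d : ℝ) + 4) * α₀ + 240000 * ((d : ℝ) + 1) ^ 3 * ((L : ℝ) ^ k * b'))
        * ((L : ℝ) ^ k) ^ 2) * ‖X‖ * ‖v‖ :=
  norm_d1_le_of_quad
    (differentiableOn_Ck_ins L hL hG k U₀ hU₀ hα hα3 hα8 h52 B' hb' hB' hsmall' hc₃' hb'1 hρ hρsmall hρc₃ S z κ)
    (by positivity) (fun Y hY => quad_Ck_ins L hL hG k U₀ hU₀ hα hα3 hα8 h52 B' hb' hB' hsmall' hc₃' hb'1 hρsmall hρc₃ S z κ Y hY)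
    hX v

end Literature.MathematicalPhysics.QuantumFieldTheory.Balaban1983to89.B11Ineq189LeafCk

end
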